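import Literature.Geometry.Riemannian.RegularSublevelDomain
import Literature.Geometry.Riemannian.BoundaryFlatteningChart
import Literature.Geometry.Riemannian.CompositeChartEnergy
import Mathlib.Geometry.Manifold.PartitionOfUnity
import HarnessLib

/-!
# Connected smooth regular sublevel domains containing a compact set

Topic `Geometry/Riemannian`. Theorem file (no definitions, no named facts; everything proved),
refining `RegularSublevelDomain.lean`: on a CONNECTED Hausdorff second countable `C^∞` manifold
`M` modelled on `ℝᵐ`, every compact `K` lies in a smooth relatively compact regular sublevel domain
`{σ < 0}` which is moreover CONNECTED (J. Milnor, *Topology from the Differentiable Viewpoint*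
(1965), §2–§3; J. M. Lee, *Introduction to Smooth Manifolds* (2013), Prop. 2.28, Thm. 6.10 — with
the elementary topology of components of a regular domain). Construction:

1. `exists_isCompact_isConnected_superset` — `K` lies in a compact connected `K⁺` (finitely many
   path-connected relatively compact neighbourhoods joined to a base point by paths; manifolds are
   locally path connected, and connected ones are path connected);
2. a regular sublevel domain `S = {σ₀ < 0} ⊇ K⁺` (`exists_regular_sublevel_domain`) and the
   component `C` of `S` containing `K⁺`;
3. `closure C` and `closure (S \\ C)` are disjoint: at points of `S` by local connectedness of `M`,
   at points of `∂S = {σ₀ = 0}` by the **local connectedness of `S` at regular boundary points**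
   (`isPreconnected_sublevel_inter_compositePiece_ball`, `BoundaryFlatteningChart.lean`);
4. a smooth `χ ∈ [0, 1]` vanishing on `closure C` and equal to `1` on `closure (S \\ C)` (smooth
   Urysohn, Mathlib's `exists_smooth_zero_one_of_isClosed`), and `σ = σ₀ + L χ` with `L` larger
   than `-min σ₀`: then `{σ < 0} = C`, `{σ ≤ 0} ⊆ {σ₀ ≤ 0}` is compact, and at a zero of `σ` one has
   `σ₀ = 0`, `χ = 0 = min χ`, so `dσ = dσ₀ ≠ 0`.

* `exists_connected_regular_sublevel_domain` (`mvfderiv σ ≠ 0` on `{σ = 0}`, as in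
  `exists_regular_sublevel_domain`) and
  `exists_connected_regular_sublevel_domain_gradSq` (Riemannian form, `|∇σ|²_g > 0`).

Used to choose the (connected) domain of the Neumann problem in the discharge of
`Literature.Geometry.Riemannian.sharpLogSobolevAVR_four`.

## References

* J. Milnor, *Topology from the Differentiable Viewpoint* (1965), §2–§3. [MilnorTDV1965]
* J. M. Lee, *Introduction to Smooth Manifolds*, 2nd ed. (2013), Prop. 2.28, Thm. 6.10.
  [LeeSmoothManifolds2013]
-/

noncomputable section

open Set Function Filter TopologicalSpace Manifold Metric
open scoped Manifold ContDiff Topology RealInnerProductSpace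

namespace Literature.Geometry.Riemannian

open Literature.Geometry.Manifold

variable {m : ℕ} {M : Type*} [TopologicalSpace M] [ChartedSpace (EuclideanSpace ℝ (Fin m)) M]
  [IsManifold (𝓡 m) ∞ M] [T2Space M] [SecondCountableTopology M]

/-! ### A compact connected superset -/

/-- **Every compact subset of a connected, locally compact, locally path-connected Hausdorff
space lies in a compact connected subset**: cover `K` by finitely many path-connected
neighbourhoods with compact closures and join each to a base point by a path. [folklore] -/
theorem exists_isCompact_isConnected_superset {X : Type*} [TopologicalSpace X] [T2Space X]
    [LocallyPathConnectedSpace X] [LocallyCompactSpace X] [ConnectedSpace X] {K : Set X}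
    (hK : IsCompact K) (x₀ : X) :
    ∃ K' : Set X, IsCompact K' ∧ IsConnected K' ∧ K ⊆ K' ∧ x₀ ∈ K' := by
  haveI : PathConnectedSpace X := PathConnectedSpace.of_locallyPathConnectedSpace
  -- path-connected neighbourhoods with compact closures
  have hV : ∀ x : X, ∃ V : Set X, V ∈ 𝓝 x ∧ IsPathConnected V ∧ IsCompact (closure V) := fun x => by
    obtain ⟨N, hNc, hN⟩ := exists_compact_mem_nhds x
    obtain ⟨V, ⟨hVn, hVp⟩, hVN⟩ := (path_connected_basis x).mem_iff.1 hN
    exact ⟨V, hVn, hVp, hNc.of_isClosed_subset isClosed_closure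
      (closure_minimal hVN hNc.isClosed)⟩
  choose V hVn hVp hVc using hV
  obtain ⟨t, -, hKt⟩ := hK.elim_nhds_subcover V fun x _ => hVn x
  -- paths from the base point
  have hγ : ∀ x : X, ∃ γ : Path x₀ x, True := fun x => ⟨(PathConnectedSpace.joined x₀ x).somePath, trivial⟩
  choose γ _ using hγ
  set piece : X → Set X := fun x => closure (V x) ∪ range (γ x) with hpiece
  have hpc : ∀ x, IsConnected (piece x) := fun x => by
    refine IsConnected.union ⟨x, subset_closure (mem_of_mem_nhds (hVn x)), ?_⟩
      (hVp x).isConnected.closure (isConnected_range (γ x).continuous)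
    exact ⟨1, (γ x).target⟩
  have hpk : ∀ x, IsCompact (piece x) := fun x =>
    (hVc x).union (isCompact_range (γ x).continuous)
  have hp0 : ∀ x, x₀ ∈ piece x := fun x => Or.inr ⟨0, (γ x).source⟩
  refine ⟨insert x₀ (⋃ x ∈ t, piece x), ?_, ?_, ?_, mem_insert _ _⟩
  · exact (t.isCompact_biUnion fun x _ => hpk x).insert x₀
  · refine ⟨⟨x₀, mem_insert _ _⟩, ?_⟩
    have e : insert x₀ (⋃ x ∈ t, piece x) = ⋃₀ (insert {x₀} ((fun x => piece x) '' (t : Set X))) := by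
      ext y
      simp only [mem_insert_iff, mem_iUnion, exists_prop, sUnion_insert, singleton_union,
        sUnion_image, Finset.mem_coe]
    rw [e]
    refine isPreconnected_sUnion x₀ _ (fun s hs => ?_) (fun s hs => ?_)
    · rcases hs with rfl | ⟨x, -, rfl⟩
      · exact mem_singleton _
      · exact hp0 x
    · rcases hs with rfl | ⟨x, -, rfl⟩
      · exact isPreconnected_singleton
      · exact (hpc x).isPreconnected
  · intro y hy
    obtain ⟨x, hx, hyx⟩ := mem_iUnion₂.1 (hKt hy)
    exact mem_insert_of_mem _ (mem_iUnion₂.2 ⟨x, hx, Or.inl (subset_closure hyx)⟩)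

/-! ### Components of a regular sublevel domain have disjoint closures -/

omit [T2Space M] [SecondCountableTopology M] in
/-- **A preconnected subset of an open set meeting a component lies in it.** [folklore] -/
theorem subset_connectedComponentIn_of_inter_nonempty {S W : Set M} {x : M}
    (hW : IsPreconnected W) (hWS : W ⊆ S) (hne : (W ∩ connectedComponentIn S x).Nonempty) :
    W ⊆ connectedComponentIn S x := by
  obtain ⟨q, hqW, hqC⟩ := hne
  rw [connectedComponentIn_eq hqC]
  exact hW.subset_connectedComponentIn hqW hWS

omit [T2Space M] [SecondCountableTopology M] in
/-- **Local connectedness at regular boundary points separates the components**: for `σ₀` smooth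
with `dσ₀ ≠ 0` on `{σ₀ = 0}`, `S = {σ₀ < 0}` and a component `C` of `S`, the closures of `C` and of
`S \\ C` are disjoint. [folklore] -/
theorem disjoint_closure_component_closure_diff {σ₀ : M → ℝ}
    (hσ₀ : ContMDiff (𝓡 m) 𝓘(ℝ, ℝ) ∞ σ₀)
    (hreg : ∀ x, σ₀ x = 0 → mfderiv (𝓡 m) 𝓘(ℝ, ℝ) σ₀ x ≠ 0) (x : M) :
    Disjoint (closure (connectedComponentIn {p | σ₀ p < 0} x))
      (closure ({p | σ₀ p < 0} \ connectedComponentIn {p | σ₀ p < 0} x)) := by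
  haveI : LocallyPathConnectedSpace M :=
    ChartedSpace.locallyPathConnectedSpace (EuclideanSpace ℝ (Fin m)) M
  set S : Set M := {p | σ₀ p < 0} with hS
  set C := connectedComponentIn S x with hC
  have hSo : IsOpen S := isOpen_lt hσ₀.continuous continuous_const
  have hCS : C ⊆ S := connectedComponentIn_subset _ _
  rw [disjoint_iff_inter_eq_empty, eq_empty_iff_forall_notMem]
  rintro p ⟨hpC, hpD⟩
  -- a preconnected "neighbourhood within `S`" of `p`, meeting both `C` and `S \ C`, gives a contradiction
  have key : ∀ W U : Set M, IsPreconnected W → W ⊆ S → U ∈ 𝓝 p → S ∩ U ⊆ W → False := by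
    intro W U hW hWS hU hUW
    have h1 : (U ∩ C).Nonempty := mem_closure_iff_nhds.1 hpC U hU
    have h2 : (U ∩ (S \ C)).Nonempty := mem_closure_iff_nhds.1 hpD U hU
    obtain ⟨q, hqU, hqC⟩ := h1
    obtain ⟨q', hq'U, hq'S, hq'C⟩ := h2
    have hWC : W ⊆ C :=
      subset_connectedComponentIn_of_inter_nonempty hW hWS ⟨q, hUW ⟨hCS hqC, hqU⟩, hqC⟩
    exact hq'C (hWC (hUW ⟨hq'S, hq'U⟩))
  have hple : σ₀ p ≤ 0 := by
    have hcl : closure C ⊆ {p | σ₀ p ≤ 0} :=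
      closure_minimal (hCS.trans fun q (hq : σ₀ q < 0) => hq.le) (isClosed_le hσ₀.continuous continuous_const)
    exact hcl hpC
  rcases hple.lt_or_eq with hlt | heq
  · -- interior point of `S`: a connected open neighbourhood inside `S`
    obtain ⟨W, ⟨hWo, hpW, hWc⟩, hWS⟩ :=
      (LocallyConnectedSpace.open_connected_basis p).mem_iff.1 (hSo.mem_nhds hlt)
    exact key W W hWc.isPreconnected hWS (hWo.mem_nhds hpW) inter_subset_right
  · -- boundary point: flatten and use the convex half-ball
    obtain ⟨Ψ, ν, R, -, hR, hΨV, hzΨ, hΨz, -, -, hball, hlin⟩ :=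
      exists_boundaryFlatteningChart hσ₀ heq (hreg p heq)
    set φ := extChartAt (𝓡 m) p
    set U : Set M := φ.source ∩ φ ⁻¹' (Ψ.symm '' ball (φ p) R)
    have hbt : ball (φ p) R ⊆ Ψ.target := ball_subset_closedBall.trans hball
    have hUo : IsOpen U := isOpen_compositePiece isOpen_ball hbt
    have hpU : p ∈ U := mem_compositePiece hzΨ hΨz (mem_ball_self hR)
    have hW : IsPreconnected (S ∩ U) := isPreconnected_sublevel_inter_compositePiece_ball hΨV hlin hbt
    exact key (S ∩ U) U hW inter_subset_left (hUo.mem_nhds hpU) Subset.rfl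

/-! ### The derivative of a smooth function vanishes at a minimum -/

omit [T2Space M] [SecondCountableTopology M] in
/-- At a global minimum of a differentiable real function on a manifold (boundaryless model) the
manifold derivative vanishes (read in the chart: Fermat). [folklore] -/
theorem mfderiv_eq_zero_of_isMinOn {χ : M → ℝ} {p : M} (hχ : MDifferentiableAt (𝓡 m) 𝓘(ℝ, ℝ) χ p)
    (hmin : ∀ q, χ p ≤ χ q) : mfderiv (𝓡 m) 𝓘(ℝ, ℝ) χ p = 0 := by
  set φ := extChartAt (𝓡 m) p with hφ
  have hd : DifferentiableAt ℝ (χ ∘ φ.symm) (φ p) :=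
    differentiableAt_comp_extChartAt_symm_of_mem p (mem_extChartAt_source p) hχ
  have hloc : IsLocalMin (χ ∘ φ.symm) (φ p) :=
    Filter.Eventually.of_forall fun y => by
      simp only [Function.comp_apply, φ.left_inv (mem_extChartAt_source p)]
      exact hmin _
  have h0 : fderiv ℝ (χ ∘ φ.symm) (φ p) = 0 := hloc.fderiv_eq_zero
  rw [hχ.mfderiv]
  simp only [writtenInExtChartAt, extChartAt_model_space_eq_id, PartialEquiv.refl_coe,
    Function.id_comp, ModelWithCorners.Boundaryless.range_eq_univ, fderivWithin_univ]
  exact h0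

/-! ### The connected regular domain -/

/-- **Connected smooth relatively compact regular domains containing a compact set.** On a
connected Hausdorff second countable `C^∞` manifold modelled on `ℝᵐ`, for every compact `K` there
is a `C^∞` function `σ` with `K ⊆ {σ < 0}`, `{σ ≤ 0}` compact, `{σ < 0}` connected and nonempty,
and `dσ_x ≠ 0` whenever `σ x = 0`. [cite: MilnorTDV1965, §3, Corollary (Brown) p. 17]
[cite: LeeSmoothManifolds2013, Prop. 2.28] -/
theorem exists_connected_regular_sublevel_domain [ConnectedSpace M] [Nonempty M] {K : Set M}
    (hK : IsCompact K) :
    ∃ σ : M → ℝ, ContMDiff (𝓡 m) 𝓘(ℝ, ℝ) ∞ σ ∧ K ⊆ {x | σ x < 0} ∧ IsCompact {x | σ x ≤ 0} ∧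
      IsConnected {x | σ x < 0} ∧ ∀ x, σ x = 0 → mvfderiv (𝓡 m) σ x ≠ 0 := by
  haveI : LocallyPathConnectedSpace M :=
    ChartedSpace.locallyPathConnectedSpace (EuclideanSpace ℝ (Fin m)) M
  haveI : LocallyCompactSpace M := ChartedSpace.locallyCompactSpace (EuclideanSpace ℝ (Fin m)) M
  haveI : SigmaCompactSpace M := sigmaCompactSpace_of_locallyCompact_secondCountable
  obtain ⟨x₀⟩ := ‹Nonempty M›
  -- Step 1: a compact connected superset
  obtain ⟨K', hK'c, hK'conn, hKK', hx₀K'⟩ := exists_isCompact_isConnected_superset hK x₀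
  -- Step 2: a regular sublevel domain containing it
  obtain ⟨σ₀, hσ₀, hK'S, hcpt, -, hreg0⟩ := exists_regular_sublevel_domain (m := m) hK'c
  have hreg : ∀ x, σ₀ x = 0 → mfderiv (𝓡 m) 𝓘(ℝ, ℝ) σ₀ x ≠ 0 := fun x hx h0 =>
    hreg0 x hx (by simp [mvfderiv, h0])
  set S : Set M := {x | σ₀ x < 0} with hS
  have hSo : IsOpen S := isOpen_lt hσ₀.continuous continuous_const
  -- Step 3: the component of `x₀`
  set C := connectedComponentIn S x₀ with hC
  have hx₀S : x₀ ∈ S := hK'S hx₀K'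
  have hCS : C ⊆ S := connectedComponentIn_subset _ _
  have hCo : IsOpen C := hSo.connectedComponentIn
  have hK'C : K' ⊆ C := hK'conn.isPreconnected.subset_connectedComponentIn hx₀K' hK'S
  have hCconn : IsConnected C := isConnected_connectedComponentIn_iff.2 hx₀S
  have hdisj := disjoint_closure_component_closure_diff hσ₀ hreg x₀
  -- Step 4: the separating bump and the modified function
  obtain ⟨χ, hχ0, hχ1, hχ01⟩ := exists_contMDiffMap_zero_one_of_isClosed (I := 𝓡 m) (M := M)
    (n := ⊤) isClosed_closure isClosed_closure hdisj
  -- a lower bound for `σ₀` on the compact `{σ₀ ≤ 0}`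
  obtain ⟨L, hL⟩ : ∃ L : ℝ, ∀ x, σ₀ x ≤ 0 → -L ≤ σ₀ x := by
    by_cases hne : ({x | σ₀ x ≤ 0} : Set M).Nonempty
    · obtain ⟨x₁, -, hmin⟩ := hcpt.exists_isMinOn hne hσ₀.continuous.continuousOn
      exact ⟨-σ₀ x₁, fun x hx => by have := hmin hx; simpa using this⟩
    · exact ⟨0, fun x hx => absurd ⟨x, hx⟩ hne⟩
  set Lc : ℝ := |L| + 1 with hLc
  have hLc0 : 0 < Lc := by positivity
  set σ : M → ℝ := σ₀ + (fun _ => Lc) * (⇑χ : M → ℝ) with hσ_def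
  have hσx : ∀ y, σ y = σ₀ y + Lc * χ y := fun y => rfl
  have hχs : ContMDiff (𝓡 m) 𝓘(ℝ, ℝ) ∞ (⇑χ : M → ℝ) := χ.contMDiff
  have hσs : ContMDiff (𝓡 m) 𝓘(ℝ, ℝ) ∞ σ := by
    have h1 : ContMDiff (𝓡 m) 𝓘(ℝ, ℝ) ∞ fun y => Lc * χ y := contMDiff_const.mul hχs
    exact hσ₀.add h1
  have hχnn : ∀ x, 0 ≤ χ x := fun x => (hχ01 x).1
  -- `{σ < 0} = C`
  have hsub : ∀ x, σ x < 0 ↔ x ∈ C := fun x => by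
    constructor
    · intro hx
      have hx0 : σ₀ x < 0 := by
        have : σ₀ x ≤ σ x := by
          rw [hσx]
          nlinarith [hχnn x]
        exact this.trans_lt hx
      by_contra hxC
      have hxD : x ∈ closure (S \ C) := subset_closure ⟨hx0, hxC⟩
      have h1 : χ x = 1 := hχ1 hxD
      have : 0 < σ x := by
        rw [hσx, h1, mul_one, hLc]
        have := hL x hx0.le
        linarith [le_abs_self L, neg_abs_le L]
      exact lt_asymm hx this
    · intro hxC
      have h0 : χ x = 0 := hχ0 (subset_closure hxC)
      rw [hσx, h0, mul_zero, add_zero]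
      exact hCS hxC
  have hset : {x | σ x < 0} = C := Set.ext hsub
  refine ⟨σ, hσs, fun x hx => (hsub x).2 (hK'C (hKK' hx)), ?_, by rw [hset]; exact hCconn,
    fun x hx => ?_⟩
  · -- `{σ ≤ 0}` is a closed subset of the compact `{σ₀ ≤ 0}`
    refine hcpt.of_isClosed_subset (isClosed_le hσs.continuous continuous_const) fun x hx => ?_
    show σ₀ x ≤ 0
    have : σ₀ x ≤ σ x := by
      rw [hσx]
      nlinarith [hχnn x]
    exact this.trans hx
  · -- regularity at the zero level: `σ₀ x = 0`, `χ x = 0` is a minimum of `χ`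
    have hx0 : σ₀ x ≤ 0 := by
      have : σ₀ x ≤ σ x := by
        rw [hσx]
        nlinarith [hχnn x]
      rw [hx] at this; exact this
    have hσ₀x : σ₀ x = 0 := by
      rcases hx0.lt_or_eq with hlt | heq
      · exfalso
        by_cases hxC : x ∈ C
        · have := (hsub x).2 hxC
          rw [hx] at this; exact lt_irrefl _ this
        · have hxD : x ∈ closure (S \ C) := subset_closure ⟨hlt, hxC⟩
          have h1 : χ x = 1 := hχ1 hxD
          have : 0 < σ x := by
            rw [hσx, h1, mul_one, hLc]
            have := hL x hlt.le
            linarith [le_abs_self L, neg_abs_le L]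
          rw [hx] at this; exact lt_irrefl _ this
      · exact heq
    have hχx : χ x = 0 := by
      have : σ₀ x + Lc * χ x = 0 := by rw [← hσx]; exact hx
      rw [hσ₀x, zero_add] at this
      exact (mul_eq_zero.1 this).resolve_left hLc0.ne'
    have hdχ : mfderiv (𝓡 m) 𝓘(ℝ, ℝ) χ x = 0 :=
      mfderiv_eq_zero_of_isMinOn (hχs.mdifferentiableAt (by simp)) fun q => by
        rw [hχx]; exact hχnn q
    have hdχv : mvfderiv (𝓡 m) (⇑χ : M → ℝ) x = 0 := by
      simp [mvfderiv, hdχ]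
    have hχmd : MDifferentiableAt (𝓡 m) 𝓘(ℝ, ℝ) (⇑χ : M → ℝ) x := hχs.mdifferentiableAt (by simp)
    have hcmd : MDifferentiableAt (𝓡 m) 𝓘(ℝ, ℝ) (fun _ : M => Lc) x := mdifferentiableAt_const
    have hσ₀md : MDifferentiableAt (𝓡 m) 𝓘(ℝ, ℝ) σ₀ x := hσ₀.mdifferentiableAt (by simp)
    have h3 : mvfderiv (𝓡 m) σ x = mvfderiv (𝓡 m) σ₀ x := by
      rw [hσ_def, mvfderiv_add hσ₀md (hcmd.mul hχmd), mvfderiv_mul hcmd hχmd, mvfderiv_const, hdχv,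
        smul_zero, smul_zero, add_zero, add_zero]
    rw [h3]
    exact hreg0 x hσ₀x

variable (g : Lorentzian.PseudoRiemannianMetric (𝓡 m) ∞ (EuclideanSpace ℝ (Fin m))
  (TangentSpace (𝓡 m) : M → Type _))

/-- **Connected smooth relatively compact regular domains, Riemannian form**: as
`exists_connected_regular_sublevel_domain`, with the regularity of the boundary expressed as
`|∇σ|²_g > 0` on `{σ = 0}`, and `{σ < 0}` nonempty. [cite: MilnorTDV1965, §3, Corollary (Brown) p. 17] -/
theorem exists_connected_regular_sublevel_domain_gradSq [ConnectedSpace M] [Nonempty M]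
    (hg : g.IsRiemannian) {K : Set M} (hK : IsCompact K) :
    ∃ σ : M → ℝ, ContMDiff (𝓡 m) 𝓘(ℝ, ℝ) ∞ σ ∧ K ⊆ {x | σ x < 0} ∧ IsCompact {x | σ x ≤ 0} ∧
      IsConnected {x | σ x < 0} ∧ (∃ x, σ x < 0) ∧ ∀ x, σ x = 0 → 0 < g.gradSq σ x := by
  obtain ⟨σ, hσ, hK', hc, hconn, hreg⟩ := exists_connected_regular_sublevel_domain (m := m) hK
  exact ⟨σ, hσ, hK', hc, hconn, hconn.nonempty,
    fun x hx => gradSq_pos_of_mvfderiv_ne_zero g hg (hreg x hx)⟩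

end Literature.Geometry.Riemannian

end
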